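import Mathlib
import Summits.Ventures.DiscreteObjects.Mahler.HardyContraction
import Summits.Ventures.DiscreteObjects.Mahler.SmythArith

/-!
# Smyth's theorem: the four-term Parseval inequality (venture `DiscreteObjects`, target L)

Cell `pub-namedobj`, seat `pub-namedobj-mahler` (gen 8). Framing: lottery ticket; floor = certified
bounds/negative ranges.

The function-theoretic heart of [McKee–Smyth, *Around the Unit Circle*, §12.2.1–12.2.3] (Smyth 1971),
abstracted from the polynomial: a pair of Schur functions `f, g` with REAL Taylor coefficients
`fₙ, gₙ`, `f₀ = g₀ = c ∈ (0,1)` (`SmythData f g c`), linked by the "nonreciprocity relations"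

  `fₙ = gₙ + a·g_{n-k}·[k ≤ n] + b·c·[n = ℓ]`   (`n ≤ ℓ`, integers `a, b ≠ 0`, `1 ≤ k < ℓ`)

(which is what `f·P* = ε P·g` and `εP = P*(1 + aX^k + bX^ℓ) + O(X^{ℓ+1})` give), must have
`c² + c³ ≤ 1`, i.e. `M = 1/c` satisfies `M³ ≥ M + 1`, i.e. `M ≥ θ₀` (`smyth_analytic`).

This file: `jetCoeff_pow_mul'`, `jetCoeff_conj_of_symm` (conjugation symmetry ⇒ real Taylor
coefficients), `jetCoeff_comb4`, and `parseval4` — the four-term Parseval inequality for a Schur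
function with real coefficients (from `hardy_contraction`), the analytic input of §12.2.2.
The case analysis itself is in `SmythAnalytic.lean`.
-/

namespace Summit.Ventures.DiscreteObjects.Mahler

open Polynomial Metric Set Filter Topology Finset
open scoped ComplexConjugate

noncomputable section

/-! ### More on Taylor coefficients -/

/-- Coefficients of `z^m · F`: shifted by `m`, zero below `m`. -/
theorem jetCoeff_pow_mul' {r : ℝ} (hr : 0 < r) {F : ℂ → ℂ} (hF : DifferentiableOn ℂ F (ball 0 r))
    (m n : ℕ) : jetCoeff (fun z => z ^ m * F z) n = if m ≤ n then jetCoeff F (n - m) else 0 := by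
  split_ifs with h
  · have := jetCoeff_pow_mul hr hF m (n - m)
    rw [Nat.sub_add_cancel h] at this
    exact this
  · push Not at h
    have hd : DifferentiableOn ℂ (fun z => z ^ m * F z) (ball 0 r) := (differentiableOn_id.pow m).mul hF
    have hc : ContinuousAt F 0 := (hF.differentiableAt (ball_mem_nhds _ hr)).continuousAt
    have := jetCoeff_unique' (N := m) (c := fun _ => 0) hr hd hc (fun z _ => by simp) n h
    simpa using this

/-- A function with the symmetry `F (z̄) = conj (F z)` has real Taylor coefficients. -/
theorem jetCoeff_conj_of_symm {r : ℝ} (hr : 0 < r) {F : ℂ → ℂ} (hF : DifferentiableOn ℂ F (ball 0 r))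
    (hsym : ∀ z, F (conj z) = conj (F z)) (n : ℕ) : conj (jetCoeff F n) = jetCoeff F n := by
  set ψ := jetTail F (n + 1) with hψ
  have hψc : ContinuousAt ψ 0 := continuousAt_jetTail hr hF (n + 1)
  have hψ'c : ContinuousAt (fun z => conj (ψ (conj z))) 0 := by
    have h1 : ContinuousAt (fun z : ℂ => conj z) 0 := Complex.continuous_conj.continuousAt
    have h2 : ContinuousAt ψ (conj (0 : ℂ)) := by rw [map_zero]; exact hψc
    have h3 : ContinuousAt (fun z => ψ (conj z)) 0 := ContinuousAt.comp (g := ψ) h2 h1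
    exact (Complex.continuous_conj.continuousAt).comp h3
  have hexp : ∀ z ∈ ball (0 : ℂ) r,
      F z = (∑ m ∈ range (n + 1), conj (jetCoeff F m) * z ^ m) + z ^ (n + 1) * conj (ψ (conj z)) := by
    intro z _
    have h := jet_eq F (n + 1) (conj z)
    have h2 : F z = conj (F (conj z)) := by rw [hsym, Complex.conj_conj]
    rw [h2, h, map_add, map_mul, map_sum, map_pow, Complex.conj_conj]
    congr 1
    apply Finset.sum_congr rfl
    intro m _
    rw [map_mul, map_pow, Complex.conj_conj]
  have := jetCoeff_unique' hr (F := F) (c := fun m => conj (jetCoeff F m)) hF hψ'c hexp n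
    (Nat.lt_add_one n)
  exact this.symm

/-- Coefficients of a four-term combination `u₀F + u₁z^iF + u₂z^jF + u₃z^lF`. -/
theorem jetCoeff_comb4 {F : ℂ → ℂ} (hF : DifferentiableOn ℂ F (ball 0 1)) (u₀ u₁ u₂ u₃ : ℂ)
    (i j l n : ℕ) :
    jetCoeff (fun z => u₀ * F z + u₁ * (z ^ i * F z) + u₂ * (z ^ j * F z) + u₃ * (z ^ l * F z)) n =
      u₀ * jetCoeff F n + u₁ * (if i ≤ n then jetCoeff F (n - i) else 0) +
        u₂ * (if j ≤ n then jetCoeff F (n - j) else 0) +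
        u₃ * (if l ≤ n then jetCoeff F (n - l) else 0) := by
  have hd : ∀ m : ℕ, DifferentiableOn ℂ (fun z => z ^ m * F z) (ball 0 1) :=
    fun m => (differentiableOn_id.pow m).mul hF
  have dA : DifferentiableOn ℂ (fun z => u₀ * F z) (ball 0 1) := hF.const_mul u₀
  have dB : DifferentiableOn ℂ (fun z => u₁ * (z ^ i * F z)) (ball 0 1) := (hd i).const_mul u₁
  have dC : DifferentiableOn ℂ (fun z => u₂ * (z ^ j * F z)) (ball 0 1) := (hd j).const_mul u₂
  have dD : DifferentiableOn ℂ (fun z => u₃ * (z ^ l * F z)) (ball 0 1) := (hd l).const_mul u₃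
  have dAB : DifferentiableOn ℂ (fun z => u₀ * F z + u₁ * (z ^ i * F z)) (ball 0 1) := dA.add dB
  have dABC : DifferentiableOn ℂ (fun z => u₀ * F z + u₁ * (z ^ i * F z) + u₂ * (z ^ j * F z))
      (ball 0 1) := dAB.add dC
  rw [jetCoeff_add one_pos dABC dD, jetCoeff_add one_pos dAB dC, jetCoeff_add one_pos dA dB,
    jetCoeff_const_mul one_pos hF, jetCoeff_const_mul one_pos (hd i),
    jetCoeff_const_mul one_pos (hd j), jetCoeff_const_mul one_pos (hd l),
    jetCoeff_pow_mul' one_pos hF, jetCoeff_pow_mul' one_pos hF, jetCoeff_pow_mul' one_pos hF]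

/-- The squared norms of the coefficients of `u₀ + u₁X^i + u₂X^j + u₃X^l` (`0 < i < j < l`, real `u`). -/
theorem norm_sq_coeff_comb4 (u₀ u₁ u₂ u₃ : ℝ) {i j l : ℕ} (hi : 0 < i) (hij : i < j) (hjl : j < l)
    (n : ℕ) :
    ‖(C (u₀ : ℂ) + C (u₁ : ℂ) * X ^ i + C (u₂ : ℂ) * X ^ j + C (u₃ : ℂ) * X ^ l).coeff n‖ ^ 2 =
      (if n = 0 then u₀ ^ 2 else 0) + (if n = i then u₁ ^ 2 else 0) + (if n = j then u₂ ^ 2 else 0) +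
        (if n = l then u₃ ^ 2 else 0) := by
  simp only [coeff_add, coeff_C, coeff_C_mul_X_pow]
  by_cases h0 : n = 0
  · subst h0
    simp [hi.ne, (hi.trans hij).ne, ((hi.trans hij).trans hjl).ne]
  by_cases h1 : n = i
  · subst h1
    simp [h0, hij.ne, (hij.trans hjl).ne]
  by_cases h2 : n = j
  · subst h2
    simp [h0, hij.ne', hjl.ne]
  by_cases h3 : n = l
  · subst h3
    simp [h0, (hij.trans hjl).ne', hjl.ne']
  simp [h0, h1, h2, h3]

/-- **Four-term Parseval inequality.**  For a Schur function `F` with real Taylor coefficients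
`Rₙ` and real `u₀,…,u₃`, `0 < i < j < l`: the coefficients of `(u₀ + u₁zⁱ + u₂zʲ + u₃zˡ)·F` in
degrees `0, i, j, l` have sum of squares at most `u₀² + u₁² + u₂² + u₃²`. -/
theorem parseval4 {F : ℂ → ℂ} (hF : IsSchur F) (hreal : ∀ n, conj (jetCoeff F n) = jetCoeff F n)
    (u₀ u₁ u₂ u₃ : ℝ) {i j l : ℕ} (hi : 0 < i) (hij : i < j) (hjl : j < l) :
    (u₀ * (jetCoeff F 0).re) ^ 2 + (u₀ * (jetCoeff F i).re + u₁ * (jetCoeff F 0).re) ^ 2 +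
      (u₀ * (jetCoeff F j).re + u₁ * (jetCoeff F (j - i)).re + u₂ * (jetCoeff F 0).re) ^ 2 +
      (u₀ * (jetCoeff F l).re + u₁ * (jetCoeff F (l - i)).re + u₂ * (jetCoeff F (l - j)).re +
        u₃ * (jetCoeff F 0).re) ^ 2 ≤ u₀ ^ 2 + u₁ ^ 2 + u₂ ^ 2 + u₃ ^ 2 := by
  set R : ℕ → ℝ := fun n => (jetCoeff F n).re with hR
  have hre : ∀ n, jetCoeff F n = ((R n : ℝ) : ℂ) := fun n => (Complex.conj_eq_iff_re.mp (hreal n)).symm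
  set p : ℂ[X] := C (u₀ : ℂ) + C (u₁ : ℂ) * X ^ i + C (u₂ : ℂ) * X ^ j + C (u₃ : ℂ) * X ^ l with hp
  -- degree bound
  have hdeg : p.natDegree + 1 ≤ l + 1 := by
    have h1 : (C (u₀ : ℂ)).natDegree ≤ l := by rw [natDegree_C]; omega
    have h2 : (C (u₁ : ℂ) * X ^ i).natDegree ≤ l := (natDegree_C_mul_X_pow_le _ _).trans (by omega)
    have h3 : (C (u₂ : ℂ) * X ^ j).natDegree ≤ l := (natDegree_C_mul_X_pow_le _ _).trans (by omega)
    have h4 : (C (u₃ : ℂ) * X ^ l).natDegree ≤ l := natDegree_C_mul_X_pow_le _ _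
    have := (natDegree_add_le _ _).trans (max_le ((natDegree_add_le _ _).trans
      (max_le ((natDegree_add_le _ _).trans (max_le h1 h2)) h3)) h4)
    rw [hp]; omega
  -- Hardy contraction
  have hH := hardy_contraction hF p (l + 1)
  -- the right-hand side
  have hRHS : ∑ n ∈ range (p.natDegree + 1), ‖p.coeff n‖ ^ 2 ≤ u₀ ^ 2 + u₁ ^ 2 + u₂ ^ 2 + u₃ ^ 2 := by
    have hsub : range (p.natDegree + 1) ⊆ range (l + 1) := range_subset_range.mpr hdeg
    have h1 : ∑ n ∈ range (p.natDegree + 1), ‖p.coeff n‖ ^ 2 ≤ ∑ n ∈ range (l + 1), ‖p.coeff n‖ ^ 2 :=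
      sum_le_sum_of_subset_of_nonneg hsub (fun n _ _ => by positivity)
    have h2 : ∑ n ∈ range (l + 1), ‖p.coeff n‖ ^ 2 = u₀ ^ 2 + u₁ ^ 2 + u₂ ^ 2 + u₃ ^ 2 := by
      rw [hp]
      simp_rw [norm_sq_coeff_comb4 u₀ u₁ u₂ u₃ hi hij hjl]
      rw [sum_add_distrib, sum_add_distrib, sum_add_distrib, sum_ite_eq', sum_ite_eq', sum_ite_eq',
        sum_ite_eq']
      simp only [Finset.mem_range]
      rw [if_pos (by omega), if_pos (by omega), if_pos (by omega), if_pos (by omega)]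
    linarith
  -- the left-hand side: the four coefficients
  have hfun : (fun z => p.eval z * F z) =
      fun z => (u₀ : ℂ) * F z + (u₁ : ℂ) * (z ^ i * F z) + (u₂ : ℂ) * (z ^ j * F z) +
        (u₃ : ℂ) * (z ^ l * F z) := by
    funext z; rw [hp]; simp only [eval_add, eval_mul, eval_C, eval_pow, eval_X]; ring
  have hcoef : ∀ n, jetCoeff (fun z => p.eval z * F z) n =
      (u₀ : ℂ) * jetCoeff F n + (u₁ : ℂ) * (if i ≤ n then jetCoeff F (n - i) else 0) +
        (u₂ : ℂ) * (if j ≤ n then jetCoeff F (n - j) else 0) +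
        (u₃ : ℂ) * (if l ≤ n then jetCoeff F (n - l) else 0) := by
    intro n; rw [hfun]; exact jetCoeff_comb4 hF.differentiableOn _ _ _ _ i j l n
  set e : ℕ → ℂ := fun n => jetCoeff (fun z => p.eval z * F z) n with he
  have he0 : e 0 = ((u₀ * R 0 : ℝ) : ℂ) := by
    rw [he]; simp only; rw [hcoef 0, if_neg (by omega), if_neg (by omega), if_neg (by omega), hre 0]
    push_cast; ring
  have hei : e i = ((u₀ * R i + u₁ * R 0 : ℝ) : ℂ) := by
    rw [he]; simp only
    rw [hcoef i, if_pos le_rfl, if_neg (by omega), if_neg (by omega), Nat.sub_self, hre i, hre 0]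
    push_cast; ring
  have hej : e j = ((u₀ * R j + u₁ * R (j - i) + u₂ * R 0 : ℝ) : ℂ) := by
    rw [he]; simp only
    rw [hcoef j, if_pos hij.le, if_pos le_rfl, if_neg (by omega), Nat.sub_self, hre j, hre (j - i),
      hre 0]
    push_cast; ring
  have hel : e l = ((u₀ * R l + u₁ * R (l - i) + u₂ * R (l - j) + u₃ * R 0 : ℝ) : ℂ) := by
    rw [he]; simp only
    rw [hcoef l, if_pos (hij.trans hjl).le, if_pos hjl.le, if_pos le_rfl, Nat.sub_self, hre l,
      hre (l - i), hre (l - j), hre 0]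
    push_cast; ring
  -- restrict the sum to the four indices
  have hnot0 : (0 : ℕ) ∉ ({i, j, l} : Finset ℕ) := by simp; omega
  have hnoti : i ∉ ({j, l} : Finset ℕ) := by simp; omega
  have hnotj : j ∉ ({l} : Finset ℕ) := by simp; omega
  have hsub : ({0, i, j, l} : Finset ℕ) ⊆ range (l + 1) := by
    intro n hn
    simp only [Finset.mem_insert, Finset.mem_singleton] at hn
    simp only [Finset.mem_range]; omega
  have hLHS : ‖e 0‖ ^ 2 + ‖e i‖ ^ 2 + ‖e j‖ ^ 2 + ‖e l‖ ^ 2 ≤ ∑ n ∈ range (l + 1), ‖e n‖ ^ 2 := by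
    have h := sum_le_sum_of_subset_of_nonneg hsub
      (f := fun n => ‖e n‖ ^ 2) (fun n _ _ => by positivity)
    rw [sum_insert hnot0, sum_insert hnoti, sum_insert hnotj, sum_singleton] at h
    linarith
  have hsq : ∀ u : ℝ, ‖(u : ℂ)‖ ^ 2 = u ^ 2 := fun u => by rw [Complex.norm_real, Real.norm_eq_abs, sq_abs]
  rw [he0, hei, hej, hel, hsq, hsq, hsq, hsq] at hLHS
  have hH' : ∑ n ∈ range (l + 1), ‖e n‖ ^ 2 ≤ u₀ ^ 2 + u₁ ^ 2 + u₂ ^ 2 + u₃ ^ 2 := hH.trans hRHS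
  exact hLHS.trans hH'

end

end Summit.Ventures.DiscreteObjects.Mahler
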